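import Summits.ABC.IUTFork.Cor312OrbitExcursionWitness
import HarnessLib

/-!
# [IUTchIII] Cor. 3.12 — DEEP graded boxes on the split shells: the cap-parametric graded frame, depth, volume and region operator

Record-only file (D-0012; MODEL DATA, no `Prop` fact) of the abc-iut cell (IUT REPAIR branch B, seat abc-iut-rp-x3 gen 4; rung
LADDER-ABC:A2.RP; abc-iut-rp-plan ruling (R30) 2026-08-26T12:39:05Z on abc-iut-rp-s1's MODEL-WANTED «uniform scalar 0 < r ≠ 1 SSFrame bed»).
TAKES NO SIDE on [IUTchIII] Cor. 3.12 and no side between Mochizuki, Scholze–Stix, Joshi or Dupuy–Hilado; typed ≠ proved; model data ≠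
intended objects. By-name sequel of abc-iut-rp-h3's ORBIT-EXCURSION bed P♮ₑ (`Cor312OrbitExcursionBoxes` / `…Model` / `…Thm311` / `…Witness`):
the slabs `slab c d`, graded boxes `gbox k`, elementary tensors `ePt c`, coordinates `coord c` and the transport lemma `image_gbox_of_perm`
are IMPORTED, not restated.

WHY (kernel arithmetic, part III of this series): P♮ₑ caps the depth of a hull-set at `ExcursionWitness.K = 4`; on that carrier the Θ-datum
sits in the sub-packet `𝓘^ℚ(^{S^±_{j+1},j};−)_v` (typed Thm. 3.11 (i)(a)), so only the coordinate `c ≡ true` survives the class-wise minimum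
over the (Ind1)-orbit and the hull at label `j` is `gbox (topDepth j z_j)` with `z_j ≤ 4`. An SSFrame bed carrying Scholze–Stix's (Lin) with ONE
scalar `0 < r` (abc-iut-rp-m4's `CandMochizuki41.Lin`) and honest `j²`-scaling needs `z_2 = 8·z_1 ≥ 8` — beyond the cap. This file re-does
§2 of `Cor312OrbitExcursionBoxes` with the cap a PARAMETER `D : ℕ` (P♮ₑ is morally `D = 4`): `depthAtD D`, the frame `deepFrame D` of all
graded boxes of depth `≤ D`, the average-depth log-volume `deepVol D` (monotone; invariant under capsule permutations — Step (x) non-trivially),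
the point-depth `pointDepthD D` and the region operator `deepRegion D` (equivariant under every family acting by capsule permutations). Parts II–IV
(`Cor312LinScaledModel` / `…Thm311` / `Repair/EvalLinScaledCorner`) build on it the bed P♮ˡ with (Lin) scalar `r = 1/3`.
HONEST SCOPE: interface-level toy (`l⋇ = 2`, one place, rational «norms» standing in for `p`-adic balls); no judgement on print; no `Prop`
fact; standard axioms. [claim: Mochizuki2012, status: disputed] for every IUT noun. [cite: DupuyHilado2020, §4.7, §4.12]
-/

noncomputable section

open Set

namespace Summit.ABC.IUTFork.Cor312Vol

namespace DeepBoxes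

open Thm311 Cor312 Cor312.IdentifiedNonVacuity NaiveWitness PinnedWitness SplitWitness ExcursionWitness Literature.IUT.LogThetaLattice

variable (D : ℕ)

/-! ## 1. The depth of a region with cap `D`; the deep graded frame -/

open scoped Classical in
/-- The DEPTH of a region on the coordinate `c`, capped at `D`: the largest `d ≤ D` with `U ⊆ slab c d` (P♮ₑ's `depthAt` is the case
`D = K = 4`). [folklore] -/
def depthAtD {j : splitIndex.Label} {vQ : splitIndex.VQ} (U : Set (splitShells.Packet j vQ)) (c : splitIndex.Caps j → Bool) : ℕ :=
  Nat.findGreatest (fun d => U ⊆ slab c d) D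

/-- Depths are capped by `D`. [folklore] -/
theorem depthAtD_le {j : splitIndex.Label} {vQ : splitIndex.VQ} (U : Set (splitShells.Packet j vQ)) (c : splitIndex.Caps j → Bool) :
    depthAtD D U c ≤ D := by
  classical
  exact Nat.findGreatest_le D

/-- A slab of depth `d ≤ D` containing `U` bounds the depth from below. [folklore] -/
theorem le_depthAtD {j : splitIndex.Label} {vQ : splitIndex.VQ} {U : Set (splitShells.Packet j vQ)} {c : splitIndex.Caps j → Bool} {d : ℕ}
    (h : U ⊆ slab c d) (hd : d ≤ D) : d ≤ depthAtD D U c := by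
  classical
  exact Nat.le_findGreatest hd h

/-- If `U` escapes the slab of depth `d + 1`, its depth is at most `d`. [folklore] -/
theorem depthAtD_le_of_not_subset {j : splitIndex.Label} {vQ : splitIndex.VQ} {U : Set (splitShells.Packet j vQ)}
    {c : splitIndex.Caps j → Bool} {d : ℕ} (h : ¬ U ⊆ slab c (d + 1)) : depthAtD D U c ≤ d := by
  classical
  by_contra hlt
  have hlt' : d + 1 ≤ depthAtD D U c := by omega
  have hne : depthAtD D U c ≠ 0 := by omega
  have hP : U ⊆ slab c (depthAtD D U c) :=
    Nat.findGreatest_of_ne_zero (P := fun d => U ⊆ slab c d) (n := D) (m := depthAtD D U c) rfl hne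
  exact h (hP.trans (slab_antitone c hlt'))

/-- EXACT depth: inside the slab of depth `d ≤ D`, outside the next one. [folklore] -/
theorem depthAtD_eq {j : splitIndex.Label} {vQ : splitIndex.VQ} {U : Set (splitShells.Packet j vQ)} {c : splitIndex.Caps j → Bool} {d : ℕ}
    (h : U ⊆ slab c d) (hd : d ≤ D) (hn : ¬ U ⊆ slab c (d + 1)) : depthAtD D U c = d :=
  le_antisymm (depthAtD_le_of_not_subset D hn) (le_depthAtD D h hd)

/-- A bounded region lies in the slab of its depth on every coordinate … [folklore] -/
theorem subset_slab_depthAtD {j : splitIndex.Label} {vQ : splitIndex.VQ} {U : Set (splitShells.Packet j vQ)} (hU : U ⊆ gbox 0)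
    (c : splitIndex.Caps j → Bool) : U ⊆ slab c (depthAtD D U c) := by
  classical
  exact Nat.findGreatest_spec (P := fun d => U ⊆ slab c d) (Nat.zero_le D) (hU.trans (gbox_subset_slab 0 c))

/-- … hence in the graded box of its depth vector. [folklore] -/
theorem subset_gbox_depthAtD {j : splitIndex.Label} {vQ : splitIndex.VQ} {U : Set (splitShells.Packet j vQ)} (hU : U ⊆ gbox 0) :
    U ⊆ gbox (depthAtD D U) := fun _ hx c => subset_slab_depthAtD D hU c hx

/-- The box of the depth vector is the LEAST box of depth `≤ D` containing `U`. [folklore] -/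
theorem gbox_depthAtD_subset {j : splitIndex.Label} {vQ : splitIndex.VQ} {U : Set (splitShells.Packet j vQ)}
    {k : (splitIndex.Caps j → Bool) → ℕ} (h : U ⊆ gbox k) (hk : ∀ c, k c ≤ D) :
    (gbox (depthAtD D U) : Set (splitShells.Packet j vQ)) ⊆ gbox k :=
  gbox_antitone fun c => le_depthAtD D (h.trans (gbox_subset_slab k c)) (hk c)

/-- The depth is antitone in the region. [folklore] -/
theorem depthAtD_antitone {j : splitIndex.Label} {vQ : splitIndex.VQ} {U U' : Set (splitShells.Packet j vQ)} (h : U ⊆ U')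
    (c : splitIndex.Caps j → Bool) : depthAtD D U' c ≤ depthAtD D U c := by
  classical
  unfold depthAtD
  exact Nat.findGreatest_mono_left (fun d hd => h.trans hd) D

/-- Regions lying in the same slabs have the same depth. [folklore] -/
theorem depthAtD_congr {j j' : splitIndex.Label} {vQ vQ' : splitIndex.VQ} {U : Set (splitShells.Packet j vQ)}
    {U' : Set (splitShells.Packet j' vQ')} {c : splitIndex.Caps j → Bool} {c' : splitIndex.Caps j' → Bool}
    (h : ∀ d, U ⊆ slab c d ↔ U' ⊆ slab c' d) : depthAtD D U c = depthAtD D U' c' := by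
  classical
  unfold depthAtD
  exact le_antisymm (Nat.findGreatest_mono_left (fun d hd => (h d).1 hd) D) (Nat.findGreatest_mono_left (fun d hd => (h d).2 hd) D)

/-- **The depth vector of a graded box with depths `≤ D` is its depth vector** (the witness `2^{−k c}·e_c` separates). [folklore] -/
theorem depthAtD_gbox {j : splitIndex.Label} (vQ : splitIndex.VQ) {k : (splitIndex.Caps j → Bool) → ℕ} (hk : ∀ c, k c ≤ D)
    (c : splitIndex.Caps j → Bool) : depthAtD D (gbox k : Set (splitShells.Packet j vQ)) c = k c := by
  refine depthAtD_eq D (gbox_subset_slab k c) (hk c) fun h => ?_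
  have ht : |(2 : ℚ)⁻¹ ^ k c| * (2 : ℚ) ^ (k c) ≤ 1 :=
    (smul_ePt_mem_slab_iff vQ _ c c (k c)).1 ((pow_smul_ePt_mem_slab_iff vQ c (k c) (k c)).2 le_rfl) rfl
  have hw : ((2 : ℚ)⁻¹ ^ k c) • ePt j vQ c ∈ (gbox k : Set (splitShells.Packet j vQ)) := (smul_ePt_mem_gbox_iff vQ _ c k).2 ht
  have h2 : k c + 1 ≤ k c := (pow_smul_ePt_mem_slab_iff vQ c (k c) (k c + 1)).1 (h hw)
  omega

/-- Depths transported: `depthAtD (σ·U) c = depthAtD U (c ∘ σ)`. [folklore] -/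
theorem depthAtD_image_of_perm {Φ : splitShells.PacketAut} {j : splitIndex.Label} {vQ : splitIndex.VQ} {σ : Equiv.Perm (splitIndex.Caps j)}
    (hΦ : ∀ x, Φ j vQ x = splitShells.permute j vQ σ x) (U : Set (splitShells.Packet j vQ)) (c : splitIndex.Caps j → Bool) :
    depthAtD D (Φ j vQ '' U) c = depthAtD D U (c ∘ ⇑σ) :=
  depthAtD_congr D fun d => image_subset_slab_iff hΦ U c d

/-- The HULL-SETS of the deep frame: the graded boxes of depth `≤ D`. [folklore] -/
def deepHul (j : splitIndex.Label) (vQ : splitIndex.VQ) : Set (Set (splitShells.Packet j vQ)) :=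
  {B | ∃ k : (splitIndex.Caps j → Bool) → ℕ, (∀ c, k c ≤ D) ∧ B = gbox k}

/-- A graded box of depth `≤ D` is a hull-set. [folklore] -/
theorem gbox_mem_deepHul {j : splitIndex.Label} (vQ : splitIndex.VQ) {k : (splitIndex.Caps j → Bool) → ℕ} (hk : ∀ c, k c ≤ D) :
    gbox k ∈ deepHul D j vQ := ⟨k, hk, rfl⟩

/-- **The DEEP GRADED HULL FRAME** (every polydisc of depth `≤ D` is a hull-set): relatively compact = inside the unit box, every bounded
region admits its hull = the graded box of its capped depth vector ([IUTchIII] Rmk. 3.9.5 (i) «the smallest subset of the form `λ·𝒪` that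
contains `U`»). [folklore] -/
def deepFrame (j : splitIndex.Label) (vQ : splitIndex.VQ) : HullFrame (splitShells.Packet j vQ) where
  Hul := deepHul D j vQ
  IsBounded := fun U => U ⊆ gbox 0
  HasHull := fun _ => True
  hul_bounded := fun _ hH => by obtain ⟨k, -, rfl⟩ := hH; exact gbox_antitone fun c => Nat.zero_le _
  bounded_mono := fun _ _ h h' => h.trans h'
  exists_hul := fun U hU => ⟨gbox 0, ⟨0, fun _ => Nat.zero_le _, rfl⟩, hU⟩
  hull_mem := fun U hU _ => by
    rw [sInter_eq_of_least (S := {H | H ∈ deepHul D j vQ ∧ U ⊆ H}) (H₀ := gbox (depthAtD D U))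
      ⟨gbox_mem_deepHul D vQ (depthAtD_le D U), subset_gbox_depthAtD D hU⟩
      fun H hH => by obtain ⟨⟨k, hk, rfl⟩, hUH⟩ := hH; exact gbox_depthAtD_subset D hUH hk]
    exact gbox_mem_deepHul D vQ (depthAtD_le D U)

/-- In the deep frame the holomorphic hull of a bounded region is the graded box of its capped depth vector. [folklore] -/
theorem deepFrame_hull {j : splitIndex.Label} {vQ : splitIndex.VQ} {U : Set (splitShells.Packet j vQ)} (hU : U ⊆ gbox 0) :
    (deepFrame D j vQ).hull U = gbox (depthAtD D U) := by
  unfold HullFrame.hull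
  rw [if_pos (show (deepFrame D j vQ).IsBounded U from hU)]
  exact sInter_eq_of_least (S := {H | H ∈ deepHul D j vQ ∧ U ⊆ H}) ⟨gbox_mem_deepHul D vQ (depthAtD_le D U), subset_gbox_depthAtD D hU⟩
    fun H hH => by obtain ⟨⟨k, hk, rfl⟩, hUH⟩ := hH; exact gbox_depthAtD_subset D hUH hk

/-! ## 2. The average-depth log-volume with cap `D`: monotone, invariant under capsule permutations -/

open scoped Classical in
/-- **The LOG-VOLUME with cap `D`**: minus the AVERAGE capped depth `−(Σ_c depthAtD U c)/2^{j+1}` on bounded regions (Dupuy–Hilado's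
normalized log-measure = expectation over the `2^{j+1}` summands of the tensor packet), `0` elsewhere. [claim: Mochizuki2012, status: disputed] -/
def deepVol (j : splitIndex.Label) (vQ : splitIndex.VQ) (U : Set (splitShells.Packet j vQ)) : ℝ :=
  if U ⊆ gbox 0 then -(∑ c, (depthAtD D U c : ℝ)) / 2 ^ ((j : ℕ) + 1) else 0

/-- The log-volume of a graded box of depth `≤ D` is minus its average depth. [folklore] -/
theorem deepVol_gbox {j : splitIndex.Label} (vQ : splitIndex.VQ) {k : (splitIndex.Caps j → Bool) → ℕ} (hk : ∀ c, k c ≤ D) :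
    deepVol D j vQ (gbox k) = -(∑ c, (k c : ℝ)) / 2 ^ ((j : ℕ) + 1) := by
  unfold deepVol
  rw [if_pos (show (gbox k : Set (splitShells.Packet j vQ)) ⊆ gbox 0 from gbox_antitone fun c => Nat.zero_le _)]
  simp only [depthAtD_gbox D vQ hk]

/-- The log-volume is nonpositive. [folklore] -/
theorem deepVol_nonpos {j : splitIndex.Label} {vQ : splitIndex.VQ} (U : Set (splitShells.Packet j vQ)) : deepVol D j vQ U ≤ 0 := by
  unfold deepVol; split_ifs
  · have : (0 : ℝ) ≤ ∑ c, (depthAtD D U c : ℝ) := Finset.sum_nonneg fun c _ => Nat.cast_nonneg _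
    have h2 : (0 : ℝ) < 2 ^ ((j : ℕ) + 1) := by positivity
    exact div_nonpos_of_nonpos_of_nonneg (by linarith) h2.le
  · exact le_rfl

/-- **The log-volume is MONOTONE** on all regions (depths are antitone). [folklore] -/
theorem deepVol_mono {j : splitIndex.Label} {vQ : splitIndex.VQ} {U U' : Set (splitShells.Packet j vQ)} (h : U ⊆ U') :
    deepVol D j vQ U ≤ deepVol D j vQ U' := by
  by_cases h' : U' ⊆ gbox 0
  · have hU : U ⊆ gbox 0 := h.trans h'
    unfold deepVol; rw [if_pos hU, if_pos h']
    have hs : ∑ c, (depthAtD D U' c : ℝ) ≤ ∑ c, (depthAtD D U c : ℝ) :=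
      Finset.sum_le_sum fun c _ => by exact_mod_cast depthAtD_antitone D h c
    have h2 : (0 : ℝ) < 2 ^ ((j : ℕ) + 1) := by positivity
    exact div_le_div_of_nonneg_right (by linarith) h2.le
  · have e : deepVol D j vQ U' = 0 := by unfold deepVol; rw [if_neg h']
    rw [e]; exact deepVol_nonpos D U

/-- **The log-volume is INVARIANT under every family acting by capsule permutations** — in particular under every element of
⟨(Ind1)∪(Ind2)⟩ (`SplitWitness.actsByPerm_of_mem_closure`): Step (x) of the printed proof, NON-trivially (graded boxes move). [folklore] -/
theorem deepVol_image_of_perm {Φ : splitShells.PacketAut} {j : splitIndex.Label} {vQ : splitIndex.VQ} {σ : Equiv.Perm (splitIndex.Caps j)}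
    (hΦ : ∀ x, Φ j vQ x = splitShells.permute j vQ σ x) (U : Set (splitShells.Packet j vQ)) :
    deepVol D j vQ (Φ j vQ '' U) = deepVol D j vQ U := by
  unfold deepVol
  by_cases hU : U ⊆ gbox 0
  · rw [if_pos ((image_subset_gbox_zero_iff hΦ U).2 hU), if_pos hU]
    simp only [depthAtD_image_of_perm D hΦ]
    rw [sum_comp_perm σ fun c => (depthAtD D U c : ℝ)]
  · rw [if_neg (fun h => hU ((image_subset_gbox_zero_iff hΦ U).1 h)), if_neg hU]

/-! ## 3. The point depth and the region operator with cap `D`; equivariance -/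

open scoped Classical in
/-- The DEPTH PROFILE OF A POINT with cap `D`: on a coordinate through which the point passes (`coord c y ≠ 0`) the capped depth of the point
there, on the other coordinates `0`. [folklore] -/
def pointDepthD {j : splitIndex.Label} {vQ : splitIndex.VQ} (y : splitShells.Packet j vQ) (c : splitIndex.Caps j → Bool) : ℕ :=
  if coord j vQ c y = 0 then 0 else depthAtD D {y} c

/-- **The region operator `ρ` with cap `D`**: at a label `j ∈ 𝔽_l^⋇`, the union over the points `ψ` of the datum at the bad valuation of the
graded boxes of their capped depth profiles; the unit box at the zero label. Defined through the coordinates only, hence equivariant under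
every family acting by capsule permutations (below). [claim: Mochizuki2012, status: disputed] -/
def deepRegion (Ψ : ∀ v : splitIndex.V, v ∈ splitIndex.Vbad → Set (splitShells.StarPacket v)) (j : splitIndex.Label)
    (vQ : splitIndex.VQ) : Set (splitShells.Packet j vQ) :=
  if h : j = 0 then gbox 0 else ⋃ ψ ∈ Ψ true rfl, gbox (pointDepthD D (ψ ⟨j, h⟩))

/-- At the zero label every deep region is the unit box. [folklore] -/
theorem deepRegion_zero (Ψ : ∀ v : splitIndex.V, v ∈ splitIndex.Vbad → Set (splitShells.StarPacket v)) (vQ : splitIndex.VQ) :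
    deepRegion D Ψ 0 vQ = gbox 0 := dif_pos rfl

/-- At a label of `𝔽_l^⋇` the deep region of a ONE-POINT datum is the graded box of the point's capped depth profile. [folklore] -/
theorem deepRegion_singleton {j : splitIndex.Label} (hj : j ≠ 0) (ψ : ∀ v : splitIndex.V, splitShells.StarPacket v) (vQ : splitIndex.VQ) :
    deepRegion D (fun v _ => {ψ v}) j vQ = gbox (pointDepthD D (ψ true ⟨j, hj⟩)) := by
  unfold deepRegion; rw [dif_neg hj]
  simp only [Set.mem_singleton_iff, Set.iUnion_iUnion_eq_left]

/-- The capped depth profile of a point is transported by precomposition. [folklore] -/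
theorem pointDepthD_perm {Φ : splitShells.PacketAut} {j : splitIndex.Label} {vQ : splitIndex.VQ} {σ : Equiv.Perm (splitIndex.Caps j)}
    (hΦ : ∀ x, Φ j vQ x = splitShells.permute j vQ σ x) (y : splitShells.Packet j vQ) (c : splitIndex.Caps j → Bool) :
    pointDepthD D (Φ j vQ y) c = pointDepthD D y (c ∘ ⇑σ) := by
  unfold pointDepthD
  rw [hΦ y, coord_permute, ← hΦ y, ← Set.image_singleton, depthAtD_image_of_perm D hΦ]

/-- The graded box of a point's capped depth profile is transported: `σ·gbox (pointDepthD y) = gbox (pointDepthD (σ·y))`. [folklore] -/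
theorem image_gbox_pointDepthD {Φ : splitShells.PacketAut} {j : splitIndex.Label} {vQ : splitIndex.VQ} {σ : Equiv.Perm (splitIndex.Caps j)}
    (hΦ : ∀ x, Φ j vQ x = splitShells.permute j vQ σ x) (y : splitShells.Packet j vQ) :
    Φ j vQ '' gbox (pointDepthD D y) = gbox (pointDepthD D (Φ j vQ y)) := by
  rw [image_gbox_of_perm hΦ]
  exact congrArg gbox (funext fun c => (pointDepthD_perm D hΦ y c).symm)

/-- **(hρ) for EVERY family acting by capsule permutations** — in particular for every element of ⟨(Ind1)∪(Ind2)⟩: transporting the datum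
transports the deep region ([IUTchIII] Thm. 3.11 (i) «functorial», p. 154). [folklore] -/
theorem deepRegion_equivariant {Φ : splitShells.PacketAut} (hΦ : ActsByPerm Φ)
    (Ψ : ∀ v : splitIndex.V, v ∈ splitIndex.Vbad → Set (splitShells.StarPacket v)) (j : splitIndex.Label) (vQ : splitIndex.VQ) :
    deepRegion D (fun v hv => splitShells.starAut Φ v '' Ψ v hv) j vQ = Φ j vQ '' deepRegion D Ψ j vQ := by
  obtain ⟨σ, hσ⟩ := hΦ j vQ
  unfold deepRegion
  split_ifs with h
  · rw [image_gbox_zero hσ]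
  · rw [Set.image_iUnion₂, Set.biUnion_image]
    refine Set.iUnion₂_congr fun ψ _ => ?_
    exact (image_gbox_pointDepthD D hσ (ψ ⟨j, h⟩)).symm

end DeepBoxes

end Summit.ABC.IUTFork.Cor312Vol

end
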